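import Literature.Probability.LatticeModels.GriffithsMonotonicity
import HarnessLib

/-!
# FKG tilts of finite-volume Ising expectations: boundary condition, field, volume

Trunk G02 (T-STATMECH), topic `Probability/LatticeModels`; namespaces `Literature.StatMech`
(identities valid for every finite-volume Ising measure) and `Literature.CritIsing` (consequences of
the named finite-volume FKG inequality `ising_fkg` of
`Literature.Probability.LatticeModels.CorrelationInequalities`, threaded as a hypothesis).
Companion of `GriffithsMonotonicity` (the GKS II consequences: monotonicity in `β`, in the
graph and in the volume for the free boundary condition), whose finite-sum calculus
(`isingExpect_eq_sum_div`, `isingExpect_pos`, `spinProduct_mul_spinProduct`, …) is reused.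

The file proves, for the finite-volume Ising model `μ^{bc}_{Λ;β,h}` of `IsingModel` on an
arbitrary locally finite graph (Friedli–Velenik 2017, §3.6.3):

* `isingExpect_eq_div_of_isingWeight_eq` — the general tilting identity: if two parameter sets
  glue finite configurations identically and their Boltzmann weights satisfy
  `w₂(τ) = w₁(τ) R(glue τ)`, then `⟨f⟩₂ = ⟨f R⟩₁ / ⟨R⟩₁`;
* `isingExpect_free_le_plus_of_fkg` — `⟨f⟩^∅_{Λ;β,h} ≤ ⟨f⟩⁺_{Λ;β,h}` for nondecreasing `f`
  (Friedli–Velenik 2017, Lemma 3.23: FKG with the nondecreasing boundary factor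
  `I = exp(β ∑_{i∈Λ,j∉Λ,i∼j} σ_i)`, here `plusBoundaryFactor`);
* `isingExpect_mono_field_of_fkg` — `h ↦ ⟨f⟩^{bc}_{Λ;β,h}` is nondecreasing for nondecreasing `f`
  and `β ≥ 0` (FKG with the nondecreasing factor `exp(β Δh ∑ σ_x)`);
* `isingExpect_plus_anti_volume_of_fkg` — `⟨f⟩⁺_{Λ₂;β,h} ≤ ⟨f⟩⁺_{Λ₁;β,h}` for `Λ₁ ⊆ Λ₂` and
  nondecreasing `f` (Friedli–Velenik 2017, Lemma 3.22 / eq. (3.25): conditioning on the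
  increasing event `{σ ≡ +1 on Λ₂ ∖ Λ₁}`, here `plusIndicator`);
* `continuous_isingExpect_param`, `continuous_isingExpect_field` — joint continuity of
  `(β, h) ↦ ⟨f⟩^{bc}_{Λ;β,h}` and continuity in the field (finite sums of exponentials;
  continuity in `β` alone is `GriffithsMonotonicity.continuous_isingExpect`).

## Design

All statements are about the tree's `isingExpect G Λ β h bc f = ∫ f dμ^{bc}_{Λ;β,h}` and use
the explicit finite-sum picture `integral_isingMeasure` (measurable `f`). The field enters the
tree's weight as `exp(β(∑ σσ + h ∑ σ))` (tilt by `-β H`), so "nondecreasing in `h`" needs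
`β ≥ 0`, as everywhere in Friedli–Velenik Ch. 3. In the tree's rendering the free and the plus
measure glue the spins off `Λ` to the same value `+1`, so Lemma 3.23 needs no support
hypothesis on `f`.

## Mathlib status

No Ising model in Mathlib. Anchors: `Sym2.lift`, `Finset.sum_sdiff`, `Finset.sum_image`,
`div_div_div_cancel_right₀`, `le_div_iff₀`, `Continuous.div`, `continuous_finsetSum`.

## References

* S. Friedli, Y. Velenik, *Statistical Mechanics of Lattice Systems* (CUP 2017), §3.6.2
  (FKG inequality, Thm. 3.21), §3.6.3 (Lemma 3.22, eq. (3.25); Lemma 3.23), §3.1 (eqs. (3.2),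
  (3.6)).
-/

noncomputable section

open MeasureTheory Finset
open scoped symmDiff

namespace Literature.Probability.LatticeModels

variable {V : Type*} (G : SimpleGraph V) [DecidableEq V] [G.LocallyFinite]

/-! ### Two elementary properties of expectations -/

/-- Monotonicity of the expectation in the observable: `f ≤ g` pointwise implies `⟨f⟩ ≤ ⟨g⟩`
(measurable `f, g`; Friedli–Velenik 2017, §3.1). [cite: FriedliVelenik2017, §3.1] -/
theorem isingExpect_mono_fun (Λ : Finset V) (β h : ℝ) (bc : BoundaryCondition V)
    {f g : SpinConfig V → ℝ} (hf : Measurable f) (hg : Measurable g) (hle : ∀ σ, f σ ≤ g σ) :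
    isingExpect G Λ β h bc f ≤ isingExpect G Λ β h bc g := by
  rw [isingExpect_eq_sum_div G Λ h bc β hf, isingExpect_eq_sum_div G Λ h bc β hg]
  refine div_le_div_of_nonneg_right (sum_le_sum fun τ _ => ?_)
    (isingPartitionFunction_pos G Λ β h bc).le
  exact mul_le_mul_of_nonneg_left (hle _) (isingWeight_pos G Λ β h bc τ).le

/-! ### The tilting identity -/

/-- `glue Λ τ bc` depends on the boundary condition only through `bc.outside`. [folklore] -/
theorem glue_eq_of_outside_eq {bc₁ bc₂ : BoundaryCondition V} (hout : bc₁.outside = bc₂.outside)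
    (Λ : Finset V) (τ : Λ → ℤˣ) : glue Λ τ bc₁ = glue Λ τ bc₂ := by
  funext x
  by_cases hx : x ∈ Λ <;> simp [hx, hout]

/-- The free and the plus boundary condition glue finite configurations in the same way (the
free outside is frozen to the junk value `1`; `IsingModel`, design note). [folklore] -/
theorem glue_free_eq_glue_plus (Λ : Finset V) (τ : Λ → ℤˣ) :
    glue Λ τ .free = glue Λ τ .plus :=
  glue_eq_of_outside_eq rfl Λ τ

/-- **The tilting identity.** If two parameter sets `(β₁,h₁,bc₁)`, `(β₂,h₂,bc₂)` glue finite
configurations identically and their Boltzmann weights satisfy `w₂(τ) = w₁(τ) R(glue τ)` for a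
measurable `R`, then `⟨f⟩₂ = ⟨f R⟩₁ / ⟨R⟩₁` for every measurable `f` (change of measure between
finite-volume Gibbs distributions; Friedli–Velenik 2017, §3.6.3, proof of Lemma 3.23). [cite: FriedliVelenik2017, §3.6.3, proof of Lemma 3.23] -/
theorem isingExpect_eq_div_of_isingWeight_eq {Λ : Finset V} {β₁ h₁ β₂ h₂ : ℝ}
    {bc₁ bc₂ : BoundaryCondition V} (hout : bc₁.outside = bc₂.outside)
    {R : SpinConfig V → ℝ} (hR : Measurable R)
    (hw : ∀ τ : Λ → ℤˣ,
      isingWeight G Λ β₂ h₂ bc₂ τ = isingWeight G Λ β₁ h₁ bc₁ τ * R (glue Λ τ bc₁))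
    {f : SpinConfig V → ℝ} (hf : Measurable f) :
    isingExpect G Λ β₂ h₂ bc₂ f =
      isingExpect G Λ β₁ h₁ bc₁ (fun σ => f σ * R σ) / isingExpect G Λ β₁ h₁ bc₁ R := by
  have hZ₁ := isingPartitionFunction_pos G Λ β₁ h₁ bc₁
  rw [isingExpect_eq_sum_div G Λ h₂ bc₂ β₂ hf, isingExpect_eq_sum_div G Λ h₁ bc₁ β₁ (f := fun σ => f σ * R σ) (hf.mul hR),
    isingExpect_eq_sum_div G Λ h₁ bc₁ β₁ hR, div_div_div_cancel_right₀ hZ₁.ne']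
  have hZ₂ : isingPartitionFunction G Λ β₂ h₂ bc₂ =
      ∑ τ : Λ → ℤˣ, isingWeight G Λ β₁ h₁ bc₁ τ * R (glue Λ τ bc₁) := by
    simp only [isingPartitionFunction, hw]
  rw [hZ₂]
  congr 1
  refine sum_congr rfl fun τ _ => ?_
  rw [hw τ, ← glue_eq_of_outside_eq hout Λ τ]
  ring

/-! ### Two tilts: the field, and free-to-plus -/

/-- The Hamiltonian is affine in the field: `H_{h₂} = H_{h₁} - (h₂ - h₁) ∑_{x ∈ Λ} σ_x`
(Friedli–Velenik 2017, eq. (3.2)). [cite: FriedliVelenik2017, §3.1, eq. (3.2)] -/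
theorem isingHamiltonian_field (Λ : Finset V) (h₁ h₂ : ℝ) (bc : BoundaryCondition V)
    (σ : SpinConfig V) :
    isingHamiltonian G Λ h₂ bc σ =
      isingHamiltonian G Λ h₁ bc σ - (h₂ - h₁) * ∑ x ∈ Λ, spinAt x σ := by
  simp only [isingHamiltonian]
  ring

/-- Changing `h`: `w_{h₂}(τ) = w_{h₁}(τ) · exp(β (h₂-h₁) ∑_{x∈Λ} σ_x(glue τ))`. [folklore] -/
theorem isingWeight_field_tilt (Λ : Finset V) (β h₁ h₂ : ℝ) (bc : BoundaryCondition V)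
    (τ : Λ → ℤˣ) :
    isingWeight G Λ β h₂ bc τ = isingWeight G Λ β h₁ bc τ *
      Real.exp (β * (h₂ - h₁) * ∑ x ∈ Λ, spinAt x (glue Λ τ bc)) := by
  rw [isingWeight, isingWeight, ← Real.exp_add, isingHamiltonian_field G Λ h₁ h₂]
  congr 1
  ring

/-- The bond observable `σ_e` *read from inside `Λ`*: for `e = {a, b}` the product of the spins
of those endpoints that lie in `Λ` (so `σ_aσ_b`, `σ_a`, `σ_b` or `1`). On configurations equal to
`+1` off `Λ` it coincides with `bondSpin` (`bondSpinIn_eq_bondSpin`), and for a boundary edge it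
is a nondecreasing function of the configuration (`bondSpinIn_mono_of_mem_edgeBoundary`): this is
the factor `ω_i` of Friedli–Velenik's `I(ω) = exp(β ∑_{i∈Λ, j∉Λ, i∼j} ω_i)` (proof of Lemma 3.23). [cite: FriedliVelenik2017, §3.6.3, proof of Lemma 3.23] -/
def bondSpinIn (Λ : Finset V) (σ : SpinConfig V) : Sym2 V → ℝ :=
  Sym2.lift ⟨fun a b => (if a ∈ Λ then spinAt a σ else 1) * (if b ∈ Λ then spinAt b σ else 1),
    fun _ _ => mul_comm _ _⟩

/-- `bondSpinIn` on a concrete pair. [folklore] -/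
@[simp] theorem bondSpinIn_mk (Λ : Finset V) (σ : SpinConfig V) (a b : V) :
    bondSpinIn Λ σ s(a, b) = (if a ∈ Λ then spinAt a σ else 1) * (if b ∈ Λ then spinAt b σ else 1) :=
  rfl

/-- On configurations frozen to `+1` off `Λ`, `bondSpinIn Λ σ e = σ_e`. [folklore] -/
theorem bondSpinIn_eq_bondSpin (Λ : Finset V) {σ : SpinConfig V} (hσ : ∀ x ∉ Λ, σ x = 1)
    (e : Sym2 V) : bondSpinIn Λ σ e = bondSpin σ e := by
  induction e using Sym2.ind with
  | _ a b =>
    simp only [bondSpinIn_mk, bondSpin_mk]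
    congr 1
    · split_ifs with ha
      · rfl
      · simp [spinAt, hσ a ha]
    · split_ifs with hb
      · rfl
      · simp [spinAt, hσ b hb]

/-- `σ ↦ bondSpinIn Λ σ e` is measurable. [folklore] -/
@[fun_prop]
theorem measurable_bondSpinIn (Λ : Finset V) (e : Sym2 V) :
    Measurable fun σ : SpinConfig V => bondSpinIn Λ σ e := by
  induction e using Sym2.ind with
  | _ a b =>
    simp only [bondSpinIn_mk]
    refine Measurable.mul ?_ ?_
    · split_ifs
      · exact measurable_spinAt a
      · exact measurable_const
    · split_ifs
      · exact measurable_spinAt b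
      · exact measurable_const

/-- For a boundary edge `e` of `Λ` (an endpoint outside `Λ`), `σ ↦ bondSpinIn Λ σ e` is
nondecreasing (it is a single spin, or the constant `1`). [folklore] -/
theorem bondSpinIn_mono_of_mem_edgeBoundary {Λ : Finset V} {e : Sym2 V}
    (he : e ∈ edgeBoundary G Λ) : Monotone fun σ : SpinConfig V => bondSpinIn Λ σ e := by
  rw [mem_edgeBoundary_iff] at he
  obtain ⟨-, -, x, hxΛ, hx⟩ := he
  induction e using Sym2.ind with
  | _ a b =>
    intro σ σ' hle
    rcases Sym2.mem_iff.1 hx with rfl | rfl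
    · simp only [bondSpinIn_mk, hxΛ, if_false, one_mul]
      split_ifs
      · exact spinAt_mono b hle
      · exact le_rfl
    · simp only [bondSpinIn_mk, hxΛ, if_false, mul_one]
      split_ifs
      · exact spinAt_mono a hle
      · exact le_rfl

/-- The boundary factor `I(σ) = exp(β ∑_{e ∈ ∂Λ} σ_e^{in})` relating the plus and the free
finite-volume weights (Friedli–Velenik 2017, proof of Lemma 3.23:
`I(ω) = exp{β ∑_{i∈Λ, j∉Λ, i∼j} ω_i}`). [cite: FriedliVelenik2017, §3.6.3, proof of Lemma 3.23] -/
def plusBoundaryFactor (Λ : Finset V) (β : ℝ) (σ : SpinConfig V) : ℝ :=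
  Real.exp (β * ∑ e ∈ edgeBoundary G Λ, bondSpinIn Λ σ e)

/-- `I(σ) > 0`. [folklore] -/
theorem plusBoundaryFactor_pos (Λ : Finset V) (β : ℝ) (σ : SpinConfig V) :
    0 < plusBoundaryFactor G Λ β σ :=
  Real.exp_pos _

/-- `I` is measurable. [folklore] -/
@[fun_prop]
theorem measurable_plusBoundaryFactor (Λ : Finset V) (β : ℝ) :
    Measurable (plusBoundaryFactor G Λ β) := by
  unfold plusBoundaryFactor
  exact Real.measurable_exp.comp
    ((Finset.measurable_sum _ fun e _ => measurable_bondSpinIn Λ e).const_mul β)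

/-- `I` is nondecreasing for `β ≥ 0` (each boundary term is a single spin). [folklore] -/
theorem plusBoundaryFactor_mono (Λ : Finset V) {β : ℝ} (hβ : 0 ≤ β) :
    Monotone (plusBoundaryFactor G Λ β) := by
  intro σ σ' hle
  unfold plusBoundaryFactor
  refine Real.exp_le_exp.2 (mul_le_mul_of_nonneg_left ?_ hβ)
  exact sum_le_sum fun e he => bondSpinIn_mono_of_mem_edgeBoundary G he hle

/-- The plus Hamiltonian is the free Hamiltonian minus the boundary terms, on glued
configurations (which are `+1` off `Λ` for both boundary conditions):
`H⁺_{Λ;h}(σ) = H^∅_{Λ;h}(σ) - ∑_{e ∈ ∂Λ} σ_e^{in}` (Friedli–Velenik 2017, eqs. (3.2), (3.6)). [cite: FriedliVelenik2017, §3.1, eqs. (3.2) and (3.6)] -/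
theorem isingHamiltonian_plus_glue (Λ : Finset V) (h : ℝ) (τ : Λ → ℤˣ) :
    isingHamiltonian G Λ h .plus (glue Λ τ .plus) =
      isingHamiltonian G Λ h .free (glue Λ τ .free) -
        ∑ e ∈ edgeBoundary G Λ, bondSpinIn Λ (glue Λ τ .free) e := by
  have hout : ∀ x ∉ Λ, glue Λ τ .free x = 1 := fun x hx => by
    simp [glue_apply_of_notMem Λ τ _ hx]
  rw [← glue_free_eq_glue_plus]
  simp only [isingHamiltonian, BoundaryCondition.plus, interactionEdges_fixed,
    interactionEdges_free]
  rw [← Finset.sum_sdiff (edgesIn_subset_edgesTouching (G := G) Λ)]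
  have hb : ∑ e ∈ edgesTouching G Λ \ edgesIn G Λ, bondSpin (glue Λ τ .free) e =
      ∑ e ∈ edgeBoundary G Λ, bondSpinIn Λ (glue Λ τ .free) e :=
    sum_congr rfl fun e _ => (bondSpinIn_eq_bondSpin Λ hout e).symm
  rw [hb]
  ring

/-- **Plus weights are tilted free weights**: `w⁺(τ) = w^∅(τ) · I(glue τ)`
(Friedli–Velenik 2017, proof of Lemma 3.23:
`∑_{ω ∈ Ω⁺_Λ} e^{-H_{Λ;β,h}(ω)} = ∑_{ω} e^{-H^∅_{Λ;β,h}(ω)} I(ω)`). [cite: FriedliVelenik2017, §3.6.3, proof of Lemma 3.23] -/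
theorem isingWeight_plus_eq (Λ : Finset V) (β h : ℝ) (τ : Λ → ℤˣ) :
    isingWeight G Λ β h .plus τ =
      isingWeight G Λ β h .free τ * plusBoundaryFactor G Λ β (glue Λ τ .free) := by
  rw [isingWeight, isingWeight, plusBoundaryFactor, ← Real.exp_add, isingHamiltonian_plus_glue]
  congr 1
  ring

/-! ### Restricting a plus box: extension by `+1` and the indicator of `{σ ≡ +1 on S}` -/

/-- Extension of a finite configuration on `Λ₁` to `Λ₂ ⊇ Λ₁` by `+1`. [folklore] -/
def extendOne (Λ₁ Λ₂ : Finset V) (τ : Λ₁ → ℤˣ) : Λ₂ → ℤˣ :=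
  fun i => if h : (i : V) ∈ Λ₁ then τ ⟨i, h⟩ else 1

/-- `extendOne` is injective when `Λ₁ ⊆ Λ₂`. [folklore] -/
theorem extendOne_injective {Λ₁ Λ₂ : Finset V} (h12 : Λ₁ ⊆ Λ₂) :
    Function.Injective (extendOne Λ₁ Λ₂) := by
  intro τ τ' h
  funext ⟨x, hx⟩
  have := congrFun h ⟨x, h12 hx⟩
  simpa [extendOne, hx] using this

/-- Gluing the extension by `+1` into `Λ₂` with plus boundary condition is gluing into `Λ₁` with
plus boundary condition. [folklore] -/
theorem glue_extendOne {Λ₁ Λ₂ : Finset V} (h12 : Λ₁ ⊆ Λ₂) (τ : Λ₁ → ℤˣ) :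
    glue Λ₂ (extendOne Λ₁ Λ₂ τ) .plus = glue Λ₁ τ .plus := by
  funext x
  by_cases hx₂ : x ∈ Λ₂
  · by_cases hx₁ : x ∈ Λ₁
    · simp [hx₁, hx₂, extendOne]
    · simp [hx₁, hx₂, extendOne, BoundaryCondition.plus]
  · have hx₁ : x ∉ Λ₁ := fun h => hx₂ (h12 h)
    simp [hx₁, hx₂]

/-- A configuration on `Λ₂` that is `+1` off `Λ₁` is an extension by `+1`. [folklore] -/
theorem mem_range_extendOne {Λ₁ Λ₂ : Finset V} (h12 : Λ₁ ⊆ Λ₂) {τ : Λ₂ → ℤˣ}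
    (hτ : ∀ i : Λ₂, (i : V) ∉ Λ₁ → τ i = 1) : τ ∈ Set.range (extendOne Λ₁ Λ₂) := by
  refine ⟨fun j => τ ⟨j, h12 j.2⟩, funext fun i => ?_⟩
  by_cases hi : (i : V) ∈ Λ₁
  · simp [extendOne, hi]
  · simp [extendOne, hi, hτ i hi]

omit [DecidableEq V] in
/-- The indicator of the increasing event `{σ_x = +1 for all x ∈ S}`, written as the product
`∏_{x ∈ S} (1 + σ_x)/2` of nondecreasing nonnegative factors (Friedli–Velenik 2017, §3.6.2). [cite: FriedliVelenik2017, §3.6.2] -/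
def plusIndicator (S : Finset V) (σ : SpinConfig V) : ℝ :=
  ∏ x ∈ S, (1 + spinAt x σ) / 2

omit [DecidableEq V] in
/-- `(1 + σ_x)/2` is the indicator of `σ_x = +1`. [folklore] -/
theorem one_add_spinAt_div_two (x : V) (σ : SpinConfig V) :
    (1 + spinAt x σ) / 2 = if σ x = 1 then 1 else 0 := by
  rcases Int.units_eq_one_or (σ x) with h | h
  · simp [spinAt, h]
  · simp [spinAt, h]

omit [DecidableEq V] in
/-- `plusIndicator S σ = 1` if `σ ≡ +1` on `S`, and `= 0` otherwise. [folklore] -/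
theorem plusIndicator_eq (S : Finset V) (σ : SpinConfig V) :
    plusIndicator S σ = if ∀ x ∈ S, σ x = 1 then 1 else 0 := by
  unfold plusIndicator
  simp_rw [one_add_spinAt_div_two]
  split_ifs with h
  · exact prod_eq_one fun x hx => by simp [h x hx]
  · push Not at h
    obtain ⟨x, hx, hx1⟩ := h
    exact prod_eq_zero hx (by simp [hx1])

omit [DecidableEq V] in
/-- `plusIndicator` is measurable. [folklore] -/
@[fun_prop]
theorem measurable_plusIndicator (S : Finset V) : Measurable (plusIndicator (V := V) S) := by
  unfold plusIndicator
  exact Finset.measurable_prod _ fun x _ => ((measurable_spinAt x).const_add 1).div_const 2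

/-- In `ℤˣ` (ordered by `-1 < 1`), anything above `1` is `1`. [folklore] -/
theorem intUnits_eq_one_of_one_le {v : ℤˣ} (h : (1 : ℤˣ) ≤ v) : v = 1 := by
  rcases Int.units_eq_one_or v with h1 | h1
  · exact h1
  · subst h1
    exact absurd (Units.val_le_val.2 h) (by decide)

omit [DecidableEq V] in
/-- `plusIndicator S` is nondecreasing (the event `{σ ≡ +1 on S}` is increasing). [folklore] -/
theorem plusIndicator_mono (S : Finset V) : Monotone (plusIndicator (V := V) S) := by
  intro σ σ' hle
  rw [plusIndicator_eq, plusIndicator_eq]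
  by_cases h : ∀ x ∈ S, σ x = 1
  · have h' : ∀ x ∈ S, σ' x = 1 := fun x hx => intUnits_eq_one_of_one_le ((h x hx) ▸ hle x)
    rw [if_pos h, if_pos h']
  · rw [if_neg h]
    split_ifs <;> norm_num

/-- On a configuration glued into `Λ₂`, the indicator of `{σ ≡ +1 on Λ₂ ∖ Λ₁}` tests whether the
finite configuration is `+1` off `Λ₁`. [folklore] -/
theorem plusIndicator_glue {Λ₁ Λ₂ : Finset V} (τ : Λ₂ → ℤˣ) (bc : BoundaryCondition V) :
    plusIndicator (Λ₂ \ Λ₁) (glue Λ₂ τ bc) =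
      if ∀ i : Λ₂, (i : V) ∉ Λ₁ → τ i = 1 then 1 else 0 := by
  rw [plusIndicator_eq]
  congr 1
  refine propext ⟨fun h i hi => ?_, fun h x hx => ?_⟩
  · have := h i (mem_sdiff.2 ⟨i.2, hi⟩)
    rwa [glue_apply_of_mem Λ₂ τ bc i.2] at this
  · obtain ⟨hx₂, hx₁⟩ := mem_sdiff.1 hx
    rw [glue_apply_of_mem Λ₂ τ bc hx₂]
    exact h ⟨x, hx₂⟩ hx₁

/-- **Reindexing a plus-box sum restricted to `{σ ≡ +1 on Λ₂ ∖ Λ₁}`** by configurations on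
`Λ₁`. [folklore] -/
theorem sum_mul_plusIndicator_glue {Λ₁ Λ₂ : Finset V} (h12 : Λ₁ ⊆ Λ₂)
    (a : (Λ₂ → ℤˣ) → ℝ) (bc : BoundaryCondition V) :
    ∑ τ : Λ₂ → ℤˣ, a τ * plusIndicator (Λ₂ \ Λ₁) (glue Λ₂ τ bc) =
      ∑ τ' : Λ₁ → ℤˣ, a (extendOne Λ₁ Λ₂ τ') := by
  simp_rw [plusIndicator_glue, mul_ite, mul_one, mul_zero]
  rw [Finset.sum_ite, sum_const_zero, add_zero]
  have hset : (univ.filter fun τ : Λ₂ → ℤˣ => ∀ i : Λ₂, (i : V) ∉ Λ₁ → τ i = 1) =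
      univ.image (extendOne Λ₁ Λ₂) := by
    ext τ
    simp only [mem_filter, mem_univ, true_and, mem_image]
    constructor
    · intro hτ
      obtain ⟨τ', hτ'⟩ := mem_range_extendOne h12 hτ
      exact ⟨τ', hτ'⟩
    · rintro ⟨τ', rfl⟩ i hi
      simp [extendOne, hi]
  rw [hset, sum_image fun τ _ τ' _ h => extendOne_injective h12 h]

/-- `ℰ^b_{Λ₁} ⊆ ℰ^b_{Λ₂}` for `Λ₁ ⊆ Λ₂`. [folklore] -/
theorem edgesTouching_mono {Λ₁ Λ₂ : Finset V} (h12 : Λ₁ ⊆ Λ₂) :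
    edgesTouching G Λ₁ ⊆ edgesTouching G Λ₂ := by
  intro e he
  rw [mem_edgesTouching_iff] at he ⊢
  obtain ⟨heG, x, hx, hxe⟩ := he
  exact ⟨heG, x, h12 hx, hxe⟩

/-- **The plus Hamiltonians of nested boxes differ by a constant on configurations that are `+1`
off the smaller box**: for `Λ₁ ⊆ Λ₂` and `σ = glue Λ₁ τ plus`,
`H⁺_{Λ₂;h}(σ) = H⁺_{Λ₁;h}(σ) - |ℰ^b_{Λ₂} ∖ ℰ^b_{Λ₁}| - h |Λ₂ ∖ Λ₁|`
(Friedli–Velenik 2017, §3.6.3, proof of Lemma 3.22 / eq. (3.25)). [cite: FriedliVelenik2017, §3.6.3] -/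
theorem isingHamiltonian_plus_glue_extend {Λ₁ Λ₂ : Finset V} (h12 : Λ₁ ⊆ Λ₂) (h : ℝ)
    (τ : Λ₁ → ℤˣ) :
    isingHamiltonian G Λ₂ h .plus (glue Λ₁ τ .plus) =
      isingHamiltonian G Λ₁ h .plus (glue Λ₁ τ .plus) -
        (#(edgesTouching G Λ₂ \ edgesTouching G Λ₁) : ℝ) - h * #(Λ₂ \ Λ₁) := by
  set σ := glue Λ₁ τ .plus with hσ
  have hout : ∀ x ∉ Λ₁, spinAt x σ = 1 := fun x hx => by
    rw [hσ, spinAt, glue_apply_of_notMem Λ₁ τ _ hx]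
    simp [BoundaryCondition.plus]
  simp only [isingHamiltonian, BoundaryCondition.plus, interactionEdges_fixed]
  rw [← Finset.sum_sdiff (edgesTouching_mono G h12), ← Finset.sum_sdiff h12]
  have hE : ∑ e ∈ edgesTouching G Λ₂ \ edgesTouching G Λ₁, bondSpin σ e =
      #(edgesTouching G Λ₂ \ edgesTouching G Λ₁) := by
    rw [Finset.card_eq_sum_ones, Nat.cast_sum, Nat.cast_one]
    refine sum_congr rfl fun e he => ?_
    obtain ⟨he₂, he₁⟩ := mem_sdiff.1 he
    have hno : ∀ x ∈ e, x ∉ Λ₁ := fun x hxe hx =>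
      he₁ (mem_edgesTouching_iff.2 ⟨(mem_edgesTouching_iff.1 he₂).1, x, hx, hxe⟩)
    induction e using Sym2.ind with
    | _ a b =>
      rw [bondSpin_mk, hout a (hno a (Sym2.mem_mk_left a b)),
        hout b (hno b (Sym2.mem_mk_right a b)), one_mul]
  have hS : ∑ x ∈ Λ₂ \ Λ₁, spinAt x σ = #(Λ₂ \ Λ₁) := by
    rw [Finset.card_eq_sum_ones, Nat.cast_sum, Nat.cast_one]
    exact sum_congr rfl fun x hx => hout x (mem_sdiff.1 hx).2
  rw [hE, hS]
  ring

/-- **Plus weights of nested boxes**: for `Λ₁ ⊆ Λ₂`,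
`w⁺_{Λ₂}(extendOne τ) = w⁺_{Λ₁}(τ) · exp(β (|ℰ^b_{Λ₂} ∖ ℰ^b_{Λ₁}| + h |Λ₂ ∖ Λ₁|))`. [folklore] -/
theorem isingWeight_plus_extendOne {Λ₁ Λ₂ : Finset V} (h12 : Λ₁ ⊆ Λ₂) (β h : ℝ)
    (τ : Λ₁ → ℤˣ) :
    isingWeight G Λ₂ β h .plus (extendOne Λ₁ Λ₂ τ) = isingWeight G Λ₁ β h .plus τ *
      Real.exp (β * ((#(edgesTouching G Λ₂ \ edgesTouching G Λ₁) : ℝ) + h * #(Λ₂ \ Λ₁))) := by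
  rw [isingWeight, isingWeight, glue_extendOne h12, isingHamiltonian_plus_glue_extend G h12,
    ← Real.exp_add]
  congr 1
  ring

/-! ### Continuity in `(β, h)` -/

/-- The Boltzmann weight of a fixed finite configuration is jointly continuous in `(β, h)`
(an exponential of an affine function). [folklore] -/
theorem continuous_isingWeight (Λ : Finset V) (bc : BoundaryCondition V) (τ : Λ → ℤˣ) :
    Continuous fun p : ℝ × ℝ => isingWeight G Λ p.1 p.2 bc τ := by
  unfold isingWeight isingHamiltonian
  fun_prop

/-- **Finite-volume expectations are jointly continuous in `(β, h)`** (ratio of finite sums of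
exponentials with positive denominator; Friedli–Velenik 2017, §3.2.1, "in finite volume all
thermodynamic quantities are real-analytic"). [cite: FriedliVelenik2017, §3.2.1] -/
theorem continuous_isingExpect_param (Λ : Finset V) (bc : BoundaryCondition V)
    {f : SpinConfig V → ℝ} (hf : Measurable f) :
    Continuous fun p : ℝ × ℝ => isingExpect G Λ p.1 p.2 bc f := by
  have hform : (fun p : ℝ × ℝ => isingExpect G Λ p.1 p.2 bc f) = fun p =>
      (∑ τ : Λ → ℤˣ, isingWeight G Λ p.1 p.2 bc τ * f (glue Λ τ bc)) /
        isingPartitionFunction G Λ p.1 p.2 bc := by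
    funext p
    exact isingExpect_eq_sum_div G Λ p.2 bc p.1 hf
  rw [hform]
  refine Continuous.div ?_ ?_ fun p => (isingPartitionFunction_pos G Λ p.1 p.2 bc).ne'
  · exact continuous_finsetSum _ fun τ _ => (continuous_isingWeight G Λ bc τ).mul continuous_const
  · unfold isingPartitionFunction
    exact continuous_finsetSum _ fun τ _ => continuous_isingWeight G Λ bc τ

/-- Continuity of `h ↦ ⟨f⟩^{bc}_{Λ;β,h}`. [cite: FriedliVelenik2017, §3.2.1] -/
theorem continuous_isingExpect_field (Λ : Finset V) (β : ℝ) (bc : BoundaryCondition V)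
    {f : SpinConfig V → ℝ} (hf : Measurable f) :
    Continuous fun h : ℝ => isingExpect G Λ β h bc f := by
  have hform : (fun h : ℝ => isingExpect G Λ β h bc f) = fun h =>
      (∑ τ : Λ → ℤˣ, isingWeight G Λ β h bc τ * f (glue Λ τ bc)) /
        isingPartitionFunction G Λ β h bc :=
    funext fun h => isingExpect_eq_sum_div G Λ h bc β hf
  have hw : ∀ τ : Λ → ℤˣ, Continuous fun h : ℝ => isingWeight G Λ β h bc τ := fun τ => by
    unfold isingWeight isingHamiltonian
    fun_prop
  rw [hform]
  refine Continuous.div ?_ ?_ fun h => (isingPartitionFunction_pos G Λ β h bc).ne'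
  · exact continuous_finsetSum _ fun τ _ => (hw τ).mul continuous_const
  · unfold isingPartitionFunction
    exact continuous_finsetSum _ fun τ _ => hw τ

end Literature.Probability.LatticeModels

/-! ### Consequences of FKG -/

namespace Literature.Probability.LatticeModels

open Percolation

variable {V : Type*} (G : SimpleGraph V) [DecidableEq V] [G.LocallyFinite]

/-- **Friedli–Velenik 2017, Lemma 3.23 (free versus plus), from FKG.** For `β ≥ 0`, any field
`h`, any finite `Λ` and any nondecreasing measurable `f`: `⟨f⟩^∅_{Λ;β,h} ≤ ⟨f⟩⁺_{Λ;β,h}`.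
Proof as printed: `⟨f⟩⁺ = ⟨f I⟩^∅/⟨I⟩^∅` with the nondecreasing boundary factor `I`, and FKG
for `μ^∅_{Λ;β,h}` gives `⟨f I⟩^∅ ≥ ⟨f⟩^∅⟨I⟩^∅`. (In the tree's rendering the free measure
freezes the spins off `Λ` to `+1`, so no support hypothesis on `f` is needed.) The finite-volume
FKG inequality is the hypothesis `ising_fkg`. [cite: FriedliVelenik2017, Lemma 3.23] -/
theorem isingExpect_free_le_plus_of_fkg {β : ℝ} (hfkg : ising_fkg G (β := β)) (hβ : 0 ≤ β)
    (h : ℝ) (Λ : Finset V) {f : SpinConfig V → ℝ} (hf : Monotone f) (hfm : Measurable f) :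
    isingExpect G Λ β h .free f ≤ isingExpect G Λ β h .plus f := by
  have hR := measurable_plusBoundaryFactor G Λ β
  rw [isingExpect_eq_div_of_isingWeight_eq G (bc₁ := .free) (bc₂ := .plus) rfl hR
    (isingWeight_plus_eq G Λ β h) hfm,
    le_div_iff₀ (isingExpect_pos G Λ β h .free hR (plusBoundaryFactor_pos G Λ β))]
  exact hfkg hβ Λ h .free f (plusBoundaryFactor G Λ β) hf (plusBoundaryFactor_mono G Λ hβ) hfm hR

/-- **Monotonicity in the field, from FKG** (Friedli–Velenik 2017, §3.6.3; the `h`-derivative of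
`⟨f⟩` is `β ∑_x (⟨f σ_x⟩ - ⟨f⟩⟨σ_x⟩) ≥ 0`). For `β ≥ 0`, `h₁ ≤ h₂`, any boundary condition and
any nondecreasing measurable `f`: `⟨f⟩^{bc}_{Λ;β,h₁} ≤ ⟨f⟩^{bc}_{Λ;β,h₂}`. Proof: tilt by the
nondecreasing factor `exp(β(h₂-h₁)∑_{x∈Λ}σ_x)` and apply FKG at `(β, h₁)`. [cite: FriedliVelenik2017, §3.6.3] -/
theorem isingExpect_mono_field_of_fkg {β : ℝ} (hfkg : ising_fkg G (β := β)) (hβ : 0 ≤ β)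
    {h₁ h₂ : ℝ} (hh : h₁ ≤ h₂) (Λ : Finset V) (bc : BoundaryCondition V)
    {f : SpinConfig V → ℝ} (hf : Monotone f) (hfm : Measurable f) :
    isingExpect G Λ β h₁ bc f ≤ isingExpect G Λ β h₂ bc f := by
  let R : SpinConfig V → ℝ := fun σ => Real.exp (β * (h₂ - h₁) * ∑ x ∈ Λ, spinAt x σ)
  have hR : Measurable R :=
    Real.measurable_exp.comp ((Finset.measurable_sum _ fun x _ => measurable_spinAt x).const_mul _)
  have hRmono : Monotone R := fun σ σ' hle =>
    Real.exp_le_exp.2 (mul_le_mul_of_nonneg_left (sum_le_sum fun x _ => spinAt_mono x hle)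
      (mul_nonneg hβ (sub_nonneg.2 hh)))
  have hw : ∀ τ : Λ → ℤˣ,
      isingWeight G Λ β h₂ bc τ = isingWeight G Λ β h₁ bc τ * R (glue Λ τ bc) :=
    isingWeight_field_tilt G Λ β h₁ h₂ bc
  rw [isingExpect_eq_div_of_isingWeight_eq G (bc₁ := bc) (bc₂ := bc) rfl hR hw hfm,
    le_div_iff₀ (isingExpect_pos G Λ β h₁ bc hR fun σ => Real.exp_pos _)]
  exact hfkg hβ Λ h₁ bc f R hf hRmono hfm hR

/-- **Friedli–Velenik 2017, Lemma 3.22 / eq. (3.25) (plus expectations decrease with the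
volume), from FKG.** For `β ≥ 0`, any field `h`, finite `Λ₁ ⊆ Λ₂` and nondecreasing measurable
`f`: `⟨f⟩⁺_{Λ₂;β,h} ≤ ⟨f⟩⁺_{Λ₁;β,h}`. Proof: `μ⁺_{Λ₁} = μ⁺_{Λ₂}( · | σ ≡ +1 on Λ₂ ∖ Λ₁)`
(the Hamiltonians differ by a constant there), and conditioning on an increasing event increases
nondecreasing functions by FKG: `⟨f 1_E⟩ ≥ ⟨f⟩⟨1_E⟩`. [cite: FriedliVelenik2017, Lemma 3.22] -/
theorem isingExpect_plus_anti_volume_of_fkg {β : ℝ} (hfkg : ising_fkg G (β := β)) (hβ : 0 ≤ β)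
    (h : ℝ) {Λ₁ Λ₂ : Finset V} (h12 : Λ₁ ⊆ Λ₂)
    {f : SpinConfig V → ℝ} (hf : Monotone f) (hfm : Measurable f) :
    isingExpect G Λ₂ β h .plus f ≤ isingExpect G Λ₁ β h .plus f := by
  set D : SpinConfig V → ℝ := plusIndicator (Λ₂ \ Λ₁) with hD
  set C : ℝ := Real.exp (β * ((#(edgesTouching G Λ₂ \ edgesTouching G Λ₁) : ℝ) + h * #(Λ₂ \ Λ₁)))
    with hC
  have hCpos : 0 < C := Real.exp_pos _
  -- restricted plus-box expectations are tilted `Λ₁` sums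
  have key : ∀ {F : SpinConfig V → ℝ}, Measurable F →
      isingExpect G Λ₂ β h .plus (fun σ => F σ * D σ) =
        C * (∑ τ' : Λ₁ → ℤˣ, isingWeight G Λ₁ β h .plus τ' * F (glue Λ₁ τ' .plus)) /
          isingPartitionFunction G Λ₂ β h .plus := by
    intro F hF
    rw [isingExpect_eq_sum_div G Λ₂ h .plus β (f := fun σ => F σ * D σ)
      (hF.mul (measurable_plusIndicator _))]
    congr 1
    simp_rw [← mul_assoc]
    rw [sum_mul_plusIndicator_glue h12, Finset.mul_sum]
    refine sum_congr rfl fun τ' _ => ?_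
    rw [isingWeight_plus_extendOne G h12, glue_extendOne h12]
    ring
  have hZ₁ := isingPartitionFunction_pos G Λ₁ β h .plus
  have hZ₂ := isingPartitionFunction_pos G Λ₂ β h .plus
  -- `⟨D⟩⁺_{Λ₂} = C Z₁ / Z₂`
  have hED : isingExpect G Λ₂ β h .plus D = C * isingPartitionFunction G Λ₁ β h .plus /
      isingPartitionFunction G Λ₂ β h .plus := by
    have := key (F := fun _ => (1 : ℝ)) measurable_const
    simp only [one_mul, mul_one] at this
    rw [show (fun σ => D σ) = D from rfl] at this
    rw [this]
    rfl
  -- FKG: `⟨f⟩⟨D⟩ ≤ ⟨f D⟩`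
  have hFKG := hfkg hβ Λ₂ h .plus f D hf (plusIndicator_mono _) hfm (measurable_plusIndicator _)
  rw [show f * D = fun σ => f σ * D σ from rfl, key hfm, hED] at hFKG
  rw [isingExpect_eq_sum_div G Λ₁ h .plus β hfm, le_div_iff₀ hZ₁]
  -- cancel the common positive factor `C / Z₂`
  have hfac : 0 < C / isingPartitionFunction G Λ₂ β h .plus := div_pos hCpos hZ₂
  have h1 : isingExpect G Λ₂ β h .plus f * (C * isingPartitionFunction G Λ₁ β h .plus /
      isingPartitionFunction G Λ₂ β h .plus) =
      (isingExpect G Λ₂ β h .plus f * isingPartitionFunction G Λ₁ β h .plus) *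
        (C / isingPartitionFunction G Λ₂ β h .plus) := by ring
  have h2 : C * (∑ τ' : Λ₁ → ℤˣ, isingWeight G Λ₁ β h .plus τ' * f (glue Λ₁ τ' .plus)) /
      isingPartitionFunction G Λ₂ β h .plus =
      (∑ τ' : Λ₁ → ℤˣ, isingWeight G Λ₁ β h .plus τ' * f (glue Λ₁ τ' .plus)) *
        (C / isingPartitionFunction G Λ₂ β h .plus) := by ring
  rw [h1, h2] at hFKG
  exact le_of_mul_le_mul_right hFKG hfac


end Literature.Probability.LatticeModels
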